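import Summits.Ventures.PercRepro.S1CellSub
import Summits.Ventures.PercRepro.S1TriangleQ

/-!
# PercRepro — the cell `(11, 9)` of the `q = 4` window: the `d = 9` sub-cases with LEMMA Q (p2, gen 17)

At corank `9` either two distinct ten-point rank-`4` flats exist — then `10 + 10 = 9 + 11` is the equality case of
LEMMA A, so (LEMMA E) every circuit lies in their union and `|S₀| ≤ 14` (the `K`-weights with `mS = 14`) — or at
most one ten-point flat exists (the `RB9` rate for the eight- and nine-point flats and the constant `βK_9(10)`).
With the triangle bound `s₃ ≤ cq 9 = 20` of LEMMA Q the maximum of the two forms closes the cell `(11, 9)`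
(twin: `1.0705 → 0.934`; without LEMMA Q the sub-cases alone leave `1.07`).

* **`count_sub9`** — the case analysis: `7560·#U` is below the maximum of the two sub-case forms;
* `cellOK12` — the cell inequality (`d = 9`, `s₃ ≤ P`); `cell_eleven_nine_q` — `cellOK12 11 9 20` by kernel;
* **`rls_of_cellOK12`**, **`c025_core_eleven_nine`** — the core of rank `11` with `20` points.
Axioms: standard.
-/

open scoped Matroid

namespace PercRepro

namespace S1

open Set

variable {α : Type}

/-- **THE SUB-CASE COUNT AT `d = 9`**: (i) two distinct ten-point flats — the form `(RBK 9, 0, 14)`; (ii) at most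
one ten-point flat — the form `(RB9 9, 7560·βK_9(10), min(45, n))`. -/
theorem count_sub9 (M : Matroid α) [M.Finite] (p : ℕ) (hR : M.eRank = (p : ℕ∞)) (hn : M.E.ncard = p + 9)
    (hcirc : ∀ C, M.IsCircuit C → 3 ≤ C.encard)
    (hline : ∀ L ⊆ M.E, M.eRk L ≤ 2 → L.ncard ≤ 3) (hplane : ∀ P ⊆ M.E, M.eRk P ≤ 3 → P.ncard ≤ 6)
    (hten : ∀ X ⊆ M.E, M.eRk X ≤ 4 → X.ncard ≤ 10) (hd : M.E.encard = M.eRank + ((9 : ℕ) : ℕ∞)) (hp : 5 ≤ p)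
    {s3B s4B s5B : ℕ}
    (hb3 : {C : Set α | M.IsCircuit C ∧ C.ncard = 3}.ncard ≤ s3B)
    (hb4 : {C : Set α | M.IsCircuit C ∧ C.ncard = 4}.ncard ≤ s4B)
    (hb5 : {C : Set α | M.IsCircuit C ∧ C.ncard = 5}.ncard ≤ s5B) :
    7560 * Matroid.topCount M p 4 ≤
      max (Uform p 9 (RBK 9) 0 14 s3B s4B s5B)
        (Uform p 9 (RB9 9) (7560 * betaK 10 9) (min 45 (p + 9)) s3B s4B s5B) := by
  classical
  by_cases htwo : ∃ F F' : Set α, BigFlat M 10 F ∧ BigFlat M 10 F' ∧ F ≠ F'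
  · -- (i) two ten-point flats: LEMMA E, `|S₀| ≤ 14`; every flat at the `K` rate
    obtain ⟨F, F', ⟨hF, hclF, hrF, h10⟩, ⟨hF', hclF', hrF', h10'⟩, hne⟩ := htwo
    have hA := ncard_add_ncard_le_of_flats_ne M hline hplane hd hF hclF hrF hF' hclF' hrF' hne
    have hsum : F.ncard + F'.ncard = 9 + 11 := by omega
    have hS0 := ncard_sUnion_circuitsLE_le_of_flats_add_eq M hcirc hline hplane hd hF hclF hrF hF' hclF' hrF'
      hne hsum 5
    have hcore := ncard_rank4_Icc_le_engine M hcirc hline hplane hten 9 11 (RBK 9) 0 14 (by simpa using hS0) ?_ ?_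
    · rw [zero_mul] at hcore
      refine le_max_of_le_left ?_
      exact topCount_le_Uform M p 9 hR hn hd hp (by norm_num) (RBK 9) 0 14 hb3 hb4 hb5
        (fold_L1 M hline 9 (RBK 9) 0 14 hcore)
    · -- the `K` rate for `8 ≤ |G| ≤ 10`
      intro G hG hcl hr h8 h11
      exact weight_big_K M hline hplane hG hcl hr h8 (by omega) 9
    · -- no flat with `≥ 11` points
      intro fl hfl
      have hemp : fl = ∅ := by
        rw [Finset.eq_empty_iff_forall_notMem]
        intro G hG
        obtain ⟨hGE, hclG, hrG, h11⟩ := hfl G hG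
        have := hten G hGE hrG.le
        omega
      rw [hemp, Finset.card_empty]
  · -- (ii) at most one ten-point flat
    push Not at htwo
    have hRM : RM 9 ≤ RB9 9 := by decide
    have hcore := ncard_rank4_Icc_le_engine M hcirc hline hplane hten 9 10 (RB9 9) 1 (min (5 * 9) M.E.ncard)
      (ncard_sUnion_circuitsLE_le_min M hd) ?_ ?_
    · rw [one_mul] at hcore
      refine le_max_of_le_right ?_
      have h := topCount_le_Uform M p 9 hR hn hd hp (by norm_num) (RB9 9) (7560 * betaK 10 9)
        (min (5 * 9) M.E.ncard) hb3 hb4 hb5 (fold_L1 M hline 9 (RB9 9) (7560 * betaK 10 9) (min (5 * 9) M.E.ncard) hcore)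
      rw [hn] at h
      exact h
    · intro G hG hcl hr h8 h10
      have h89 : G.ncard = 8 ∨ G.ncard = 9 := by omega
      rcases h89 with h | h
      · exact (weight_eight_AB M hcirc hline hplane hG hcl hr h 9).trans (Nat.mul_le_mul_right _ hRM)
      · exact weight_nine_AB M hline hplane hG hcl hr h 9
    · intro fl hfl
      rw [Finset.card_le_one]
      intro G hG G' hG'
      obtain ⟨hGE, hclG, hrG, h10⟩ := hfl G hG
      obtain ⟨hGE', hclG', hrG', h10'⟩ := hfl G' hG'
      exact htwo G G' ⟨hGE, hclG, hrG, h10⟩ ⟨hGE', hclG', hrG', h10'⟩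

/-- **The `d = 9` sub-case cell inequality with the triangle cap `s₃ ≤ P`**: `cellOK8`'s inequality with the
per-flat branch replaced by the maximum of the two sub-case forms of `count_sub9`. -/
def cellOK12 (p d P : ℕ) : Bool :=
  let n := p + d
  let m := min (5 * d) n
  let s3 := min (min (d * (d + 1) / 2) ((d * d + 6 - 3 * d) / 2)) P
  let s4 := min (min (CoreRegimes.chooseF (d + 3) 4) (d * (d + 1) * (d + 2) / 3)) (fourCircuitBound d)
  let s5 := CoreRegimes.chooseF (d + 4) 5
  let piAll := s3 * CoreRegimes.chooseF (n - 3) 2 + s4 * (n - 4) + s5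
  let piS0 := s3 * CoreRegimes.chooseF (m - 3) 2 + s4 * (m - 4) + s5
  let sigs := ∑ j ∈ Finset.range (d - 5 + 1), Nat.choose 2 j
  let sig := ∑ j ∈ Finset.range (d - 5 + 1), Nat.choose 5 j
  let Upf := max (UformF p 9 (RBK 9) 0 14 s3 s4 s5) (UformF p 9 (RB9 9) (7560 * betaK 10 9) (min 45 n) s3 s4 s5)
  let U := min Upf (7560 * (CoreRegimes.chooseF n 4 + sigs * piAll + (sig - sigs) * piS0))
  let R3 := 10584 * (s3 * (n - 3) + s4)
  let R4 := RSK 10 * piAll + (RBK 10 - RSK 10) * piS0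
  let Ysum := 7560 * ∑ j ∈ Finset.Ico 5 p, CoreRegimes.chooseF n j
  let phiNum := 2 ^ (p + 4) - 2 * ∑ u ∈ Finset.range 5, CoreRegimes.chooseF (p + 4) u
  let phiDen := CoreRegimes.chooseF (p + 4) 4
  decide (d = 9 ∧ R3 + R4 ≤ Ysum ∧ phiNum * U + phiDen * (R3 + R4) ≤ phiDen * Ysum)

/-- The cell `(11, 9)` with `s₃ ≤ 20` (LEMMA Q), by kernel evaluation. -/
theorem cell_eleven_nine_q : cellOK12 11 9 20 = true := by decide +kernel

/-- **FROM THE `d = 9` SUB-CASE CELL TO `RLS`**: on the `e`-free core of rank `p ≥ 5` and corank `9` with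
`s₃ ≤ P`, a kernel-evaluated `cellOK12 p d P = true` (with `d = 9`) gives `ThmN.RLS M p 4`. -/
theorem rls_of_cellOK12 (M : Matroid α) [M.Finite] (p d P : ℕ) (hR : M.eRank = (p : ℕ∞))
    (hn : M.E.ncard = p + d)
    (hfree : ∀ e ∈ M.E, ∃ A ⊆ M.E \ {e}, e ∉ M.closure A ∧ e ∉ M.closure ((M.E \ {e}) \ A))
    (hP : {C : Set α | M.IsCircuit C ∧ C.ncard = 3}.ncard ≤ P)
    (hp : 5 ≤ p) (hok : cellOK12 p d P = true) : ThmN.RLS M p 4 := by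
  classical
  -- the core facts
  have hL : ∀ e ∈ M.E, ¬ M.IsLoop e := ThmN.not_isLoop_of_free M hfree
  have hs : ∀ e ∈ M.E, ∀ f ∈ M.E, e ≠ f → M.eRk {e, f} = 2 := by
    intro e he f hf hef
    have h2 : (2 : ℕ∞) ≤ M.eRk {e, f} :=
      ThmN.two_le_eRk_of_two_le_ncard_of_free M hfree (pair_subset he hf) (by rw [ncard_pair hef])
    have h3 : M.eRk {e, f} ≤ 2 := by
      have := M.eRk_le_encard {e, f}
      rwa [encard_pair hef] at this
    exact le_antisymm h3 h2
  have hcirc : ∀ C, M.IsCircuit C → 3 ≤ C.encard := ThmN.three_le_encard_of_circuit M hL hs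
  have hline : ∀ L ⊆ M.E, M.eRk L ≤ 2 → L.ncard ≤ 3 := by
    intro L hL' hr
    have := ThmN.ncard_add_one_le_two_pow_of_eRk_le M hL hfree 2 L hL' hr
    omega
  have hplane : ∀ P ⊆ M.E, M.eRk P ≤ 3 → P.ncard ≤ 6 := fun P hP hr =>
    ThmN.ncard_le_six_of_eRk_le_three_of_free M hfree hP hr
  have hten : ∀ X ⊆ M.E, M.eRk X ≤ 4 → X.ncard ≤ 10 := fun X hX hr =>
    ThmN.ncard_le_ten_of_eRk_le_four_of_free M hfree hX hr
  have hd : M.E.encard = M.eRank + d := by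
    rw [hR, ← M.ground_finite.cast_ncard_eq, hn]
    push_cast
    ring
  -- the spec of the cell
  have hspec : d = 9 ∧
      10584 * (min (min (d * (d + 1) / 2) ((d * d + 6 - 3 * d) / 2)) P * (p + d - 3) +
        min (min ((d + 3).choose 4) (d * (d + 1) * (d + 2) / 3)) (fourCircuitBound d)) +
      (RSK 10 * (min (min (d * (d + 1) / 2) ((d * d + 6 - 3 * d) / 2)) P * (p + d - 3).choose 2 +
          min (min ((d + 3).choose 4) (d * (d + 1) * (d + 2) / 3)) (fourCircuitBound d) * (p + d - 4) + (d + 4).choose 5) +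
        (RBK 10 - RSK 10) * (min (min (d * (d + 1) / 2) ((d * d + 6 - 3 * d) / 2)) P * (min (5 * d) (p + d) - 3).choose 2 +
          min (min ((d + 3).choose 4) (d * (d + 1) * (d + 2) / 3)) (fourCircuitBound d) * (min (5 * d) (p + d) - 4) + (d + 4).choose 5)) ≤
      7560 * ∑ j ∈ Finset.Ico 5 p, (p + d).choose j ∧
    (2 ^ (p + 4) - 2 * ∑ u ∈ Finset.range 5, (p + 4).choose u) *
        min (max (Uform p 9 (RBK 9) 0 14 (min (min (d * (d + 1) / 2) ((d * d + 6 - 3 * d) / 2)) P)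
                (min (min ((d + 3).choose 4) (d * (d + 1) * (d + 2) / 3)) (fourCircuitBound d)) ((d + 4).choose 5))
              (Uform p 9 (RB9 9) (7560 * betaK 10 9) (min 45 (p + d)) (min (min (d * (d + 1) / 2) ((d * d + 6 - 3 * d) / 2)) P)
                (min (min ((d + 3).choose 4) (d * (d + 1) * (d + 2) / 3)) (fourCircuitBound d)) ((d + 4).choose 5)))
          (7560 * ((p + d).choose 4 +
            (∑ j ∈ Finset.range (d - 5 + 1), Nat.choose 2 j) *
              (min (min (d * (d + 1) / 2) ((d * d + 6 - 3 * d) / 2)) P * (p + d - 3).choose 2 +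
                min (min ((d + 3).choose 4) (d * (d + 1) * (d + 2) / 3)) (fourCircuitBound d) * (p + d - 4) + (d + 4).choose 5) +
            ((∑ j ∈ Finset.range (d - 5 + 1), Nat.choose 5 j) - (∑ j ∈ Finset.range (d - 5 + 1), Nat.choose 2 j)) *
              (min (min (d * (d + 1) / 2) ((d * d + 6 - 3 * d) / 2)) P * (min (5 * d) (p + d) - 3).choose 2 +
                min (min ((d + 3).choose 4) (d * (d + 1) * (d + 2) / 3)) (fourCircuitBound d) * (min (5 * d) (p + d) - 4) + (d + 4).choose 5))) +
      (p + 4).choose 4 *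
        (10584 * (min (min (d * (d + 1) / 2) ((d * d + 6 - 3 * d) / 2)) P * (p + d - 3) +
            min (min ((d + 3).choose 4) (d * (d + 1) * (d + 2) / 3)) (fourCircuitBound d)) +
          (RSK 10 * (min (min (d * (d + 1) / 2) ((d * d + 6 - 3 * d) / 2)) P * (p + d - 3).choose 2 +
              min (min ((d + 3).choose 4) (d * (d + 1) * (d + 2) / 3)) (fourCircuitBound d) * (p + d - 4) + (d + 4).choose 5) +
            (RBK 10 - RSK 10) * (min (min (d * (d + 1) / 2) ((d * d + 6 - 3 * d) / 2)) P * (min (5 * d) (p + d) - 3).choose 2 +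
              min (min ((d + 3).choose 4) (d * (d + 1) * (d + 2) / 3)) (fourCircuitBound d) * (min (5 * d) (p + d) - 4) + (d + 4).choose 5))) ≤
      (p + 4).choose 4 * (7560 * ∑ j ∈ Finset.Ico 5 p, (p + d).choose j) := by
    unfold cellOK12 at hok
    simp only [CoreRegimes.chooseF_eq, UformF_eq] at hok
    exact of_decide_eq_true hok
  obtain ⟨hd9, hcell1, hcell2⟩ := hspec
  have hd4 : 4 ≤ d := by omega
  -- the counts and their caps
  set s3 := {C : Set α | M.IsCircuit C ∧ C.ncard = 3}.ncard with hs3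
  set s4 := {C : Set α | M.IsCircuit C ∧ C.ncard = 4}.ncard with hs4
  set s5 := {C : Set α | M.IsCircuit C ∧ C.ncard = 5}.ncard with hs5
  have hb3 : s3 ≤ min (min (d * (d + 1) / 2) ((d * d + 6 - 3 * d) / 2)) P := by
    have h := two_mul_ncard_triangles_le M (fun L hL hr => hline L hL hr.le) hd
    have h' : 2 * s3 ≤ d * (d + 1) := h
    have h2 := two_mul_ncard_triangles_add_three_mul_le_of_four_le M
      (fun L hL hr => hline L hL hr.le) hplane hd4 hd
    have h2' : 2 * s3 + 3 * d ≤ d * d + 6 := h2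
    refine le_min (le_min ?_ ?_) hP
    · rw [Nat.le_div_iff_mul_le (by norm_num)]; omega
    · rw [Nat.le_div_iff_mul_le (by norm_num)]; omega
  have hb4 : s4 ≤ min (min ((d + 3).choose 4) (d * (d + 1) * (d + 2) / 3)) (fourCircuitBound d) := by
    refine le_min (le_min (ncard_circuits_four_le M hd) ?_) (ncard_fourCircuits_le_fourCircuitBound M hfree hd)
    have h := three_mul_ncard_four_circuits_le M hline hplane hd
    have h' : 3 * s4 ≤ d * (d + 1) * (d + 2) := h
    rw [Nat.le_div_iff_mul_le (by norm_num)]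
    omega
  have hb5 : s5 ≤ (d + 4).choose 5 := ncard_circuits_five_le M hd
  set s3B := min (min (d * (d + 1) / 2) ((d * d + 6 - 3 * d) / 2)) P with hs3B
  set s4B := min (min ((d + 3).choose 4) (d * (d + 1) * (d + 2) / 3)) (fourCircuitBound d) with hs4B
  -- the per-flat branch: the sub-case count at `d = 9`
  have hUpf : 7560 * Matroid.topCount M p 4 ≤
      max (Uform p 9 (RBK 9) 0 14 s3B s4B ((d + 4).choose 5))
        (Uform p 9 (RB9 9) (7560 * betaK 10 9) (min 45 (p + d)) s3B s4B ((d + 4).choose 5)) := by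
    subst hd9
    exact count_sub9 M p hR hn hcirc hline hplane hten hd hp hb3 hb4 hb5
  -- the split branch and the `Y`-side, as in `rls_of_cellOK8`
  have hU1 := topCount_le_ncard_eRk_eq_four_ncard_le M hR hd
  have hU3 := ncard_eRk_eq_ncard_le_le_split_joint' M 4 10 6 (by norm_num) hcirc hten
    (fun X hX hr => hplane X hX (by simpa using hr)) hd
  rw [sum_Icc_three_five' (fun k => {C : Set α | M.IsCircuit C ∧ C.ncard = k}.ncard),
    sum_Icc_three_five' (fun k => {C : Set α | M.IsCircuit C ∧ C.ncard = k}.ncard)] at hU3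
  have hY := midCount_ge_K7 M hcirc hline hplane hten hd p
  rw [hn] at hU3 hY
  set m := min (5 * d) (p + d) with hm
  set piAll := s3 * (p + d - 3).choose 2 + s4 * (p + d - 4) + s5 with hpiAll
  set piS0 := s3 * (m - 3).choose 2 + s4 * (m - 4) + s5 with hpiS0
  set piAllB := s3B * (p + d - 3).choose 2 + s4B * (p + d - 4) + (d + 4).choose 5 with hpiAllB
  set piS0B := s3B * (m - 3).choose 2 + s4B * (m - 4) + (d + 4).choose 5 with hpiS0B
  have hpiAll_le : piAll ≤ piAllB := by
    rw [hpiAll, hpiAllB]; gcongr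
  have hpiS0_le : piS0 ≤ piS0B := by
    rw [hpiS0, hpiS0B]; gcongr
  set R34B := 10584 * (s3B * (p + d - 3) + s4B) + (RSK 10 * piAllB + (RBK 10 - RSK 10) * piS0B) with hR34B
  set sigs := ∑ j ∈ Finset.range (d - 5 + 1), Nat.choose 2 j with hsigs
  set sig := ∑ j ∈ Finset.range (d - 5 + 1), Nat.choose 5 j with hsig
  set Ysum := 7560 * ∑ j ∈ Finset.Ico 5 p, (p + d).choose j with hYsum
  set phiNum := 2 ^ (p + 4) - 2 * ∑ u ∈ Finset.range 5, (p + 4).choose u with hphiNum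
  set phiDen := (p + 4).choose 4 with hphiDen
  have hUsp : 7560 * Matroid.topCount M p 4 ≤ 7560 * ((p + d).choose 4 + sigs * piAllB + (sig - sigs) * piS0B) := by
    calc 7560 * Matroid.topCount M p 4
        ≤ 7560 * {B : Set α | B ⊆ M.E ∧ M.eRk B = 4 ∧ B.ncard ≤ d}.ncard := Nat.mul_le_mul_left _ hU1
      _ ≤ 7560 * ((p + d).choose 4 + sigs * piAll + (sig - sigs) * piS0) := Nat.mul_le_mul_left _ hU3
      _ ≤ 7560 * ((p + d).choose 4 + sigs * piAllB + (sig - sigs) * piS0B) := by gcongr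
  have hUB := le_min hUpf hUsp
  have hYB : Ysum ≤ 7560 * Matroid.midCount M p 4 + R34B := by
    calc Ysum ≤ 7560 * Matroid.midCount M p 4 + 10584 * (s3 * (p + d - 3) + s4) +
          (RSK 10 * piAll + (RBK 10 - RSK 10) * piS0) := hY
      _ ≤ 7560 * Matroid.midCount M p 4 + R34B := by
          rw [hR34B]
          have h1 : 10584 * (s3 * (p + d - 3) + s4) ≤ 10584 * (s3B * (p + d - 3) + s4B) := by gcongr
          have : RSK 10 * piAll + (RBK 10 - RSK 10) * piS0 ≤ RSK 10 * piAllB + (RBK 10 - RSK 10) * piS0B := by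
            gcongr
          omega
  have hchain : phiNum * (7560 * Matroid.topCount M p 4) ≤ phiDen * (7560 * Matroid.midCount M p 4) := by
    have h1 := Nat.mul_le_mul_left phiNum hUB
    have h2 : phiNum * _ + phiDen * R34B ≤ phiDen * Ysum := hcell2
    have h3 : phiDen * Ysum ≤ phiDen * (7560 * Matroid.midCount M p 4 + R34B) := Nat.mul_le_mul_left _ hYB
    rw [Nat.mul_add] at h3
    omega
  -- cast to `ℚ`
  have hsum : 2 * ∑ u ∈ Finset.range 5, (p + 4).choose u ≤ 2 ^ (p + 4) := by
    have := sum_Ioo_choose_add_four p hp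
    omega
  have hphiNumQ : (phiNum : ℚ) = 2 ^ (p + 4) - 2 * ∑ u ∈ Finset.range 5, ((p + 4).choose u : ℚ) := by
    rw [hphiNum, Nat.cast_sub hsum]
    push_cast
    ring
  have hΦ := phiK_four_mul_choose_eq p hp
  rw [← hphiNumQ] at hΦ
  have hDenPos : (0 : ℚ) < (phiDen : ℚ) := by
    rw [hphiDen]; exact_mod_cast Nat.choose_pos (by omega)
  have hchainQ : (phiNum : ℚ) * (Matroid.topCount M p 4 : ℚ) ≤ (phiDen : ℚ) * (Matroid.midCount M p 4 : ℚ) := by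
    have h : ((phiNum * (7560 * Matroid.topCount M p 4) : ℕ) : ℚ) ≤
        ((phiDen * (7560 * Matroid.midCount M p 4) : ℕ) : ℚ) := by exact_mod_cast hchain
    push_cast at h
    linarith
  rw [ThmN.RLS_iff]
  have hkey : phiK p 4 * (Matroid.topCount M p 4 : ℚ) * (phiDen : ℚ) ≤
      (Matroid.midCount M p 4 : ℚ) * (phiDen : ℚ) := by
    calc phiK p 4 * (Matroid.topCount M p 4 : ℚ) * (phiDen : ℚ)
        = (phiK p 4 * (phiDen : ℚ)) * (Matroid.topCount M p 4 : ℚ) := by ring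
      _ = (phiNum : ℚ) * (Matroid.topCount M p 4 : ℚ) := by rw [hphiDen, hΦ]
      _ ≤ (phiDen : ℚ) * (Matroid.midCount M p 4 : ℚ) := hchainQ
      _ = (Matroid.midCount M p 4 : ℚ) * (phiDen : ℚ) := by ring
  exact le_of_mul_le_mul_right hkey hDenPos


/-- **THE CELL `(11, 9)`**: an `e`-free core of rank `11` with `20` points satisfies `RLS` at level `4`. -/
theorem c025_core_eleven_nine (M : Matroid α) [M.Finite] (hR : M.eRank = (11 : ℕ)) (hn : M.E.ncard = 20)
    (hfree : ∀ e ∈ M.E, ∃ A ⊆ M.E \ {e}, e ∉ M.closure A ∧ e ∉ M.closure ((M.E \ {e}) \ A)) :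
    ThmN.RLS M 11 4 := by
  have hd : M.E.encard = M.eRank + ((9 : ℕ) : ℕ∞) := by
    rw [hR, ← M.ground_finite.cast_ncard_eq, hn]
    push_cast
    ring
  have hP : {C : Set α | M.IsCircuit C ∧ C.ncard = 3}.ncard ≤ 20 := by
    have h := core_ncard_triangles_le_cq M hfree hd
    rwa [show cq 9 = 20 by decide] at h
  exact rls_of_cellOK12 M 11 9 20 hR hn hfree hP (by norm_num) cell_eleven_nine_q

end S1

end PercRepro
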